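import Literature.Claims.NS.PinheiroQueiroz2025
import Literature.Claims.NS.Ri2025
import Literature.Claims.NS.Bachani2026
import Literature.Claims.NS.AbuGhuwaleh2026b
import Literature.Claims.NS.Durmagambetov2015
import Literature.Claims.NS.Qin2026
import HarnessLib

/-!
# Kernel certificates for six scalar-grain steps typed «as printed» in `Literature/Claims/NS/`

Cell `ns-claims` (D-0090) types the displayed steps of claimed Navier–Stokes proofs as named `Prop`s
«as printed»; several of its typists flag a step as *known-false as real arithmetic*, *suspicious
(strictness at an edge)*, *decorative* or *erratum-grade* and leave it unasserted.  This leaf turns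
six such flags into kernel facts — the NEGATION of the typed `Prop`, each by an explicit
witness — and, where the print plainly intends a side condition, PROVES the charitable face next to
it (for `Qin2026.Step82_58` the cell has already typed and PROVED that face, `Step82_58c` /
`step82_58c_holds`).  Nothing here is a verdict on any claim (the cell's locators of record are its
own `SoloRefute*` theorems); none of the six `Prop`s is a hypothesis of its file's `claim_of_steps`
except `PinheiroQueiroz2025.Step_S54`, which that composition takes as an UNUSED binder (`_hS54`).
No definition, no new named fact (D-0026); statements of the six `def`s are untouched.

* `PinheiroQueiroz2025.step_S54_false` — «−2s + 1 < 2 ⟹ s > 5/2» fails at `s = 0`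
  (the cell's `s54_at_zero` records the same instance without the negation).
* `Ri2025.levelCountPattern_false` — the level-count shape `Σ_{k∈K} f(g k) ≤ |T|·M` fails for a
  non-injective level map (`K = {0,1}`, `T = {0}`, `g ≡ 0`, `f ≡ 1`, `M = 1`: `2 ≤ 1`);
  `Ri2025.levelCountPattern_of_injOn` — it HOLDS for `g` injective on `K` and `M ≥ 0`
  (the typist's «valid when `g` is injective on `K`»; `M ≥ 0` is needed as well: `K = ∅`,
  `T = {0}`, `M = −1`).
* `Bachani2026.step_L62s4_false` — «ν𝒟 − ℰ > 0» fails at the edge `Y = D = E = 0` (the typist's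
  flag «strictness at `Y = 0`»); `Bachani2026.step_L62s4_of_pos` — it HOLDS for `Y > 0`.
* `AbuGhuwaleh2026b.erratum251_rhsFinite_false` — the weighted summability transfer fails for
  `s ≥ 1 − ε/2` (witness `ε = s = E₀ = C = 1`, `x ≡ 0`: the general term is `4ᴶ·2⁻ᴶ = 2ᴶ ≥ 1`).
* `Durmagambetov2015.statement3_false` — Statement 3 p. 97 in the proof's form: with
  `A = 4/(ν^{1/3}(CC₀+1)^{2/3})` one has `A^{3/2} = 8/(ν^{1/2}(CC₀+1))`, so
  `K = 1/(1 − (π/2)CC₀(CC₀+1))`; at `ν = C = 1`, `C₀ = 1/4` the denominator is `1 − 5π/32 > 0` and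
  `K = 1/(1 − 5π/32) > 8/7` (the typist's «known-false pattern», there with `CC₀ = 1/5`).
* `Qin2026.step82_58_false` — the ODE comparison typed with RIGHT derivatives only
  (`HasDerivWithinAt y (D t) (Ici t) t`) and no continuity fails for a function that jumps DOWN:
  `y = (1 − t)⁻¹` on `[0, 1/2)`, `y = (10 − t)⁻¹` on `[1/2, 1)` has `y' = y²` from the right
  everywhere on `[0, 1)`, `y > 0`, `y(0) = 1`, yet `y(1/2) = 2/19 < 2 = 1/(y(0)⁻¹ − 1/2)`
  (the typing artefact recorded in `Qin2026.lean` next to `Step82_58c`).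

Sources: the five claim skeletons (their docstrings quote the print: Pinheiro–Queiroz 2025 §5.4 p. 6;
Ri 2025 §3 l. 817–821; Bachani 2026 Lemma 6.2 Step 4 p. 7; Abu-Ghuwaleh 2026b (251) p. 59;
Durmagambetov–Fazilova 2015 Statement 3 p. 97; Qin 2026 Cor. 8.2 (58) p. 28). [folklore] arithmetic
and one-variable calculus throughout.
-/

noncomputable section

open Set Finset

/-! ### Pinheiro–Queiroz 2025, Step S54 -/

namespace Literature.Claims.NS.PinheiroQueiroz2025

/-- **`Step_S54` is false as typed**: at `s = 0` the antecedent `−2·0 + 1 < 2` holds and the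
consequent `5/2 < 0` fails (cf. `s54_at_zero`). [cite: PinheiroQueiroz2025, §5.4 p.6 l.23–27] -/
theorem step_S54_false : ¬ Step_S54 := by
  intro h
  have h0 := h 0 (by norm_num)
  norm_num at h0

end Literature.Claims.NS.PinheiroQueiroz2025

/-! ### Ri 2025, the level-count shape -/

namespace Literature.Claims.NS.Ri2025

/-- **`LevelCountPattern` is false as typed** (no injectivity of the level map): `K = {0, 1}`,
`T = {0}`, `g ≡ 0`, `f ≡ 1`, `M = 1` give `Σ_{k∈K} f(g k) = 2 > 1 = |T|·M`.
[cite: Ri2025, §3 Step 2 l.817–821] -/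
theorem levelCountPattern_false : ¬ LevelCountPattern := by
  intro h
  have h1 := h ({0, 1} : Finset ℕ) ({0} : Finset ℕ) (fun _ => 0) (fun _ => (1 : ℝ)) 1
    (fun k _ => by simp) (fun k _ => by simp)
  norm_num [Finset.sum_const] at h1

/-- **The level-count shape under its intended side conditions**: if the level map `g` is injective
on `K` and `M ≥ 0`, then `Σ_{k∈K} f(g k) ≤ |T|·M` (at most `|K| = |g(K)| ≤ |T|` summands, each
`≤ M`). [cite: Ri2025, §3 Step 2 l.817–821] -/
theorem levelCountPattern_of_injOn (K T : Finset ℕ) (g : ℕ → ℕ) (f : ℕ → ℝ) (M : ℝ)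
    (hM : 0 ≤ M) (hg : Set.InjOn g (K : Set ℕ))
    (hT : ∀ k ∈ K, g k ∈ T) (hf : ∀ k ∈ K, f (g k) ≤ M) :
    ∑ k ∈ K, f (g k) ≤ (T.card : ℝ) * M := by
  have h1 : ∑ k ∈ K, f (g k) ≤ (K.card : ℝ) * M := by
    have := Finset.sum_le_card_nsmul K (fun k => f (g k)) M hf
    simpa [nsmul_eq_mul] using this
  have h2 : K.card ≤ T.card := by
    rw [← Finset.card_image_of_injOn hg]
    exact Finset.card_le_card (Finset.image_subset_iff.2 hT)
  have h3 : (K.card : ℝ) * M ≤ (T.card : ℝ) * M :=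
    mul_le_mul_of_nonneg_right (by exact_mod_cast h2) hM
  exact h1.trans h3

end Literature.Claims.NS.Ri2025

/-! ### Bachani 2026, Lemma 6.2 Step 4 -/

namespace Literature.Claims.NS.Bachani2026

/-- **`Step_L62s4` is false as typed** — the strict conclusion `0 < ν𝒟 − ℰ` fails at the edge
`Y = 0` (then `D = 0`, `E = 0` are admissible): witness `ν = c = C = ε = 1`, `r = 1/2`,
`Y = D = E = 0`. [cite: Bachani2026, Lemma 6.2 Step 4 p.7 l.37–39] -/
theorem step_L62s4_false : ¬ Step_L62s4 := by
  intro h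
  have h0 := h 1 1 1 (1 / 2) 1 0 0 0 one_pos one_pos one_pos one_pos (by norm_num) (by norm_num)
    le_rfl (by norm_num) (by norm_num)
  norm_num at h0

/-- **The charitable face of `Step_L62s4` holds**: for `Y > 0` (positive enstrophy, as in the print's
context `S_{r*}(t) ≤ ε` of a non-trivial solution) the displayed inference is correct:
`ℰ ≤ |ℰ| ≤ C r⁻¹ Y < ν c r⁻² ε⁻¹ Y ≤ ν𝒟`, the strict step being `C < ν c ε⁻¹ r⁻¹`, i.e.
`r < ν c ε⁻¹ / C`. [cite: Bachani2026, Lemma 6.2 Step 4 p.7 l.37–39] -/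
theorem step_L62s4_of_pos (ν c C r ε Y D E : ℝ) (hν : 0 < ν) (_hc : 0 < c) (hC : 0 < C)
    (_hε : 0 < ε) (hr : 0 < r) (hrC : r < ν * c * ε⁻¹ / C) (hY : 0 < Y)
    (hD : c * r⁻¹ ^ 2 * ε⁻¹ * Y ≤ D) (hE : |E| ≤ C * r⁻¹ * Y) : 0 < ν * D - E := by
  have ha : 0 < r⁻¹ := inv_pos.2 hr
  -- `C r < ν c ε⁻¹`, hence `C < ν c ε⁻¹ r⁻¹`
  have h1 : C * r < ν * c * ε⁻¹ := by
    have := (lt_div_iff₀ hC).1 hrC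
    linarith [this]
  have h2 : C < ν * c * ε⁻¹ * r⁻¹ := by
    have h := mul_lt_mul_of_pos_right h1 ha
    have hCr : C * r * r⁻¹ = C := by
      field_simp
    linarith [h, hCr]
  -- multiply by `r⁻¹ Y > 0`
  have h3 : C * r⁻¹ * Y < ν * (c * r⁻¹ ^ 2 * ε⁻¹ * Y) := by
    have h := mul_lt_mul_of_pos_right h2 (mul_pos ha hY)
    have e1 : C * (r⁻¹ * Y) = C * r⁻¹ * Y := by ring
    have e2 : ν * c * ε⁻¹ * r⁻¹ * (r⁻¹ * Y) = ν * (c * r⁻¹ ^ 2 * ε⁻¹ * Y) := by ring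
    linarith [h, e1, e2]
  have h4 : ν * (c * r⁻¹ ^ 2 * ε⁻¹ * Y) ≤ ν * D := mul_le_mul_of_nonneg_left hD hν.le
  have h5 : E ≤ |E| := le_abs_self E
  linarith

end Literature.Claims.NS.Bachani2026

/-! ### Abu-Ghuwaleh 2026b, the line after (251) -/

namespace Literature.Claims.NS.AbuGhuwaleh2026b

/-- **`Erratum251_rhsFinite` is false as typed** (and false for every `s ≥ 1 − ε/2`, in particular
for the paper's `s > 5/2`): with `ε = s = E₀ = C = 1` and the zero data sequence `x ≡ 0` the
hypotheses hold trivially while the general term of the conclusion is `4ᴶ · 2⁻ᴶ = 2ᴶ ≥ 1`, which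
does not tend to `0`. [cite: AbuGhuwaleh2026b, (251) p.59] -/
theorem erratum251_rhsFinite_false : ¬ Erratum251_rhsFinite := by
  intro h
  have hs := h 1 one_pos (by norm_num) 1 zero_le_one 1 1 one_pos one_pos (fun _ => 0)
    (fun _ => le_rfl) (by simp [summable_zero])
  -- the general term is `≥ 1`
  have hge : ∀ J : ℕ, (1 : ℝ) ≤
      (4 : ℝ) ^ ((1 : ℝ) * (J : ℝ)) * (0 + 1 * (2 : ℝ) ^ (-((2 - 1) * (J : ℝ))) * 1 ^ 2) := by
    intro J
    have h4 : (4 : ℝ) ^ ((1 : ℝ) * (J : ℝ)) = (4 : ℝ) ^ J := by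
      rw [one_mul, Real.rpow_natCast]
    have h2 : (2 : ℝ) ^ (-((2 - 1) * (J : ℝ))) = ((2 : ℝ) ^ J)⁻¹ := by
      rw [show (-((2 - 1) * (J : ℝ))) = -(J : ℝ) by ring, Real.rpow_neg (by norm_num),
        Real.rpow_natCast]
    rw [h4, h2]
    have h2pos : (0 : ℝ) < (2 : ℝ) ^ J := by positivity
    have key : (4 : ℝ) ^ J * ((2 : ℝ) ^ J)⁻¹ = (2 : ℝ) ^ J := by
      rw [show (4 : ℝ) ^ J = (2 : ℝ) ^ J * (2 : ℝ) ^ J by rw [← mul_pow]; norm_num]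
      field_simp
    have : (4 : ℝ) ^ J * (0 + 1 * ((2 : ℝ) ^ J)⁻¹ * 1 ^ 2) = (2 : ℝ) ^ J := by
      rw [zero_add, one_mul, one_pow, mul_one, key]
    rw [this]
    exact one_le_pow₀ (by norm_num)
  -- but a summable sequence tends to `0`
  have ht := hs.tendsto_atTop_zero
  have hev := (ht.eventually (gt_mem_nhds (show (0 : ℝ) < 1 by norm_num)))
  obtain ⟨J, hJ⟩ := hev.exists
  exact absurd (hge J) (not_le.2 hJ)

end Literature.Claims.NS.AbuGhuwaleh2026b

/-! ### Durmagambetov–Fazilova 2015, Statement 3 -/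

namespace Literature.Claims.NS.Durmagambetov2015

/-- The scale factor of Statement 3 at `ν = 1`, `C = 1`, `C₀ = 1/4`:
`A^{3/2} = (4 / (1^{1/3} (5/4)^{2/3}))^{3/2} = 8 / (5/4) = 32/5`.
[cite: DurmagambetovFazilova2015NSMillennium, Statement 3 and its proof p.97] -/
theorem scaleFactor_pow_three_halves :
    (4 / ((1 : ℝ) ^ ((1 : ℝ) / 3) * (1 * (1 / 4) + 1) ^ ((2 : ℝ) / 3))) ^ ((3 : ℝ) / 2)
      = 32 / 5 := by
  have h54 : (1 * (1 / 4 : ℝ) + 1) = 5 / 4 := by norm_num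
  rw [Real.one_rpow, one_mul, h54]
  have hden : (0 : ℝ) ≤ (5 / 4 : ℝ) ^ ((2 : ℝ) / 3) := Real.rpow_nonneg (by norm_num) _
  rw [Real.div_rpow (by norm_num) hden, ← Real.rpow_mul (by norm_num : (0 : ℝ) ≤ 5 / 4)]
  have h1 : ((2 : ℝ) / 3 * ((3 : ℝ) / 2)) = 1 := by norm_num
  have h2 : (4 : ℝ) ^ ((3 : ℝ) / 2) = 8 := by
    rw [show (4 : ℝ) = (2 : ℝ) ^ ((2 : ℕ) : ℝ) by rw [Real.rpow_natCast]; norm_num,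
      ← Real.rpow_mul (by norm_num : (0 : ℝ) ≤ 2),
      show ((2 : ℕ) : ℝ) * ((3 : ℝ) / 2) = ((3 : ℕ) : ℝ) by norm_num, Real.rpow_natCast]
    norm_num
  rw [h1, Real.rpow_one, h2]
  norm_num

/-- **`Statement3` is false as typed** (the proof's form of Statement 3, p. 97, with the positivity of
the denominator as a hypothesis): at `ν = 1`, `C = 1`, `C₀ = 1/4` the denominator equals
`1 − 5π/32 > 0` (as `π < 4`) while `K = 1/(1 − 5π/32) > 8/7` (as `π > 3`; indeed `K > 32/17`).
[cite: DurmagambetovFazilova2015NSMillennium, Statement 3 and its proof p.97] -/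
theorem statement3_false : ¬ Statement3 := by
  intro h
  have hπ3 := Real.pi_gt_three
  have hπ4 := Real.pi_lt_four
  have hden : (0 : ℝ) < Real.sqrt 1 - 4 * Real.pi * 1 * (1 / 4) /
      (4 / ((1 : ℝ) ^ ((1 : ℝ) / 3) * (1 * (1 / 4) + 1) ^ ((2 : ℝ) / 3))) ^ ((3 : ℝ) / 2) := by
    rw [scaleFactor_pow_three_halves, Real.sqrt_one]
    nlinarith
  have hK := h 1 1 (1 / 4) one_pos zero_le_one (by norm_num) hden
  rw [scaleFactor_pow_three_halves, Real.sqrt_one] at hK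
  have hd : (0 : ℝ) < 1 - 4 * Real.pi * 1 * (1 / 4) / (32 / 5) := by nlinarith
  rw [div_le_iff₀ hd] at hK
  nlinarith

end Literature.Claims.NS.Durmagambetov2015

/-! ### Qin 2026, Cor. 8.2 (58) at the ODE grain, as typed (right derivatives, no continuity) -/

namespace Literature.Claims.NS.Qin2026

open Filter Topology in
/-- **`Step82_58` is false as typed.** Witness: `C = T = 1`, `y t = (1 − t)⁻¹` for `t < 1/2` and
`y t = (10 − t)⁻¹` for `t ≥ 1/2`, `D = y²`: `y > 0` on `[0,1)`, `y` has right derivative `y²`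
within `[t, ∞)` at every `t ∈ [0,1)` (at `t = 1/2` only the right branch is seen), `C·(1/2) = 1/2 <
1 = y(0)⁻¹`, but `1/(y(0)⁻¹ − 1/2) = 2 > 2/19 = y(1/2)`. With `y` continuous the statement holds
(`step82_58c_holds`). [cite: Qin2026, Cor 8.2 (58) p.28 l.2–14] -/
theorem step82_58_false : ¬ Step82_58 := by
  intro h
  -- the witness and its two branches
  have hv1 : ∀ s : ℝ, s < 1 / 2 →
      (fun t : ℝ => if t < 1 / 2 then (1 - t)⁻¹ else (10 - t)⁻¹) s = (1 - s)⁻¹ := by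
    intro s hs
    show (if s < 1 / 2 then (1 - s)⁻¹ else (10 - s)⁻¹) = (1 - s)⁻¹
    rw [if_pos hs]
  have hv2 : ∀ s : ℝ, 1 / 2 ≤ s →
      (fun t : ℝ => if t < 1 / 2 then (1 - t)⁻¹ else (10 - t)⁻¹) s = (10 - s)⁻¹ := by
    intro s hs
    show (if s < 1 / 2 then (1 - s)⁻¹ else (10 - s)⁻¹) = (10 - s)⁻¹
    rw [if_neg (not_lt.2 hs)]
  -- positivity on `[0, 1)`
  have hpos : ∀ t ∈ Ico (0 : ℝ) 1,
      0 < (fun t : ℝ => if t < 1 / 2 then (1 - t)⁻¹ else (10 - t)⁻¹) t := by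
    intro t ht
    by_cases h1 : t < 1 / 2
    · rw [hv1 t h1]; exact inv_pos.2 (by linarith)
    · rw [hv2 t (not_lt.1 h1)]; exact inv_pos.2 (by linarith [ht.2])
  -- right derivative `y' = y²` within `[t, ∞)` at every `t ∈ [0, 1)`
  have hder : ∀ t ∈ Ico (0 : ℝ) 1,
      HasDerivWithinAt (fun t : ℝ => if t < 1 / 2 then (1 - t)⁻¹ else (10 - t)⁻¹)
        ((fun t : ℝ => (fun t : ℝ => if t < 1 / 2 then (1 - t)⁻¹ else (10 - t)⁻¹) t ^ 2) t)
        (Ici t) t ∧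
      1 * (fun t : ℝ => if t < 1 / 2 then (1 - t)⁻¹ else (10 - t)⁻¹) t ^ 2 ≤
        (fun t : ℝ => (fun t : ℝ => if t < 1 / 2 then (1 - t)⁻¹ else (10 - t)⁻¹) t ^ 2) t := by
    intro t ht
    refine ⟨?_, by simp⟩
    by_cases h1 : t < 1 / 2
    · -- left branch, an open condition: a genuine derivative
      have hne : (1 - t) ≠ 0 := by linarith
      have hd : HasDerivAt (fun s : ℝ => (1 - s)⁻¹) (-(-1) / (1 - t) ^ 2) t :=
        ((hasDerivAt_id t).const_sub 1).inv hne
      have hd' : HasDerivAt (fun s : ℝ => (1 - s)⁻¹) ((1 - t)⁻¹ ^ 2) t :=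
        hd.congr_deriv (by rw [inv_pow, neg_neg, one_div])
      have heq : (fun t : ℝ => if t < 1 / 2 then (1 - t)⁻¹ else (10 - t)⁻¹) =ᶠ[𝓝 t]
          fun s : ℝ => (1 - s)⁻¹ :=
        Filter.eventually_of_mem (Iio_mem_nhds h1) fun s hs => hv1 s hs
      have hy : HasDerivAt (fun t : ℝ => if t < 1 / 2 then (1 - t)⁻¹ else (10 - t)⁻¹)
          ((1 - t)⁻¹ ^ 2) t := hd'.congr_of_eventuallyEq heq
      simpa only [hv1 t h1] using hy.hasDerivWithinAt
    · -- right branch (including the jump point `t = 1/2`): only `[t, ∞)` is seen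
      have h1' : 1 / 2 ≤ t := not_lt.1 h1
      have hne : (10 - t) ≠ 0 := by linarith [ht.2]
      have hd : HasDerivAt (fun s : ℝ => (10 - s)⁻¹) (-(-1) / (10 - t) ^ 2) t :=
        ((hasDerivAt_id t).const_sub 10).inv hne
      have hd' : HasDerivWithinAt (fun s : ℝ => (10 - s)⁻¹) ((10 - t)⁻¹ ^ 2) (Ici t) t :=
        (hd.congr_deriv (by rw [inv_pow, neg_neg, one_div])).hasDerivWithinAt
      have heq : (fun t : ℝ => if t < 1 / 2 then (1 - t)⁻¹ else (10 - t)⁻¹) =ᶠ[𝓝[Ici t] t]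
          fun s : ℝ => (10 - s)⁻¹ :=
        eventually_nhdsWithin_of_forall fun s hs => hv2 s (h1'.trans hs)
      have hy := hd'.congr_of_eventuallyEq heq (hv2 t h1')
      simpa only [hv2 t h1'] using hy
  have key := h 1 1 (fun t : ℝ => if t < 1 / 2 then (1 - t)⁻¹ else (10 - t)⁻¹)
    (fun t : ℝ => (fun t : ℝ => if t < 1 / 2 then (1 - t)⁻¹ else (10 - t)⁻¹) t ^ 2)
    one_pos one_pos hpos hder (1 / 2) ⟨by norm_num, by norm_num⟩
    (by rw [if_pos (by norm_num : (0 : ℝ) < 1 / 2)]; norm_num)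
  rw [if_pos (by norm_num : (0 : ℝ) < 1 / 2), if_neg (lt_irrefl (1 / 2 : ℝ))] at key
  norm_num at key

end Literature.Claims.NS.Qin2026

end
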